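import Mathlib
import Summits.HodgeConjecture.FermatCycles.HodgeFermatPropL7cB

/-!
# THEOREM U from LEMMA W — the all-unit case of THEOREM D6 reduced to a character-free statement about residues (`HodgeFermat/TheoremU.lean`; HF-G22c)

Tree copy (whole module) of the module `HodgeFermat/TheoremU.lean` of the sibling cell's standalone package
`run/shared/lean/pub/pub-hodgefermat/lean/HodgeFermat/` (365 lines, sha256 `f39e81a54da7a3fd…`), source lines 48–365 (all: `resTransform`, `LemmaW`, `HypW`, the weights `wt`, `allunit_share`, `thmU_of_W`, `theoremD6_of_W`).
Filed by cell `pub-hfermat`, seat prover-1 gen-3, on the COORDINATOR KEEPER RULING of 2026-08-25 (gem sweep H1: take the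
off-gate kernel theorem `thmFstar` through the gate) — here THEOREM F* of `tables/DPRIME-THEOREM.md` §9 IN FULL, i.e.
PROPOSITION D′(3N) and the descent (`HodgeFermat/PropDPrimeNFinal.lean`, GATE HF-G34), the last off-gate form of THEOREM F*
(its first two forms, `DecodingFinal.thmFstar` = F* at the prime levels and `ThmFstarNFinal.thmFstar` = F*(3N), landed on
2026-08-25 as `HodgeFermatThmFstar.lean` / `HodgeFermatThmFstarN.lean`, seats prover-1 gen-0 / gen-2); this file is one link of
the import closure of `PropDPrimeNFinal.propDprime` (the sibling's KR-free chain: THEOREM L, COROLLARY M, THEOREM D6,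
THEOREM U⁺, THEOREM KR6, THEOREM Z3U) on top of those landed chains.  The source module is the sibling's hub-checked module of
record (pub-hodgefermat `CERT.md` l.888, GATE HF-G22c; cell record `check/TheoremU_standalone.lean` sha256 `fb52950e93b1a6a2…`); its declarations are copied VERBATIM.
Deviations from the source module, exhaustively: the `import` lines (tree modules `Summits.HodgeConjecture.FermatCycles.
HodgeFermat*` instead of `HodgeFermat.*`); this module docstring; DEDUP (pre-empting the gate's `dedup.landed`): the source's `lemma mul_mod_mod` (l.123–124) is VERBATIM (up to names) `HodgeFermat.KRFree.PropZ5.mul_mod_mod` of `HodgeFermatPropZ5A.lean` (in the import closure) and is DELETED, re-bound by the added line `open HodgeFermat.KRFree.PropZ5 (mul_mod_mod)`; one-line docstrings added (gate lint) to `δ_nonneg`, `δ_self`, `δ_ne`, `coprime_mod`, `not_dvd_of_coprime`, `pos_of_coprime`, `wt_eq_zero_of_ne`.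
Every other line — in particular every declaration's statement and proof — is byte-identical to the source.
HONEST FRAMING: explicit algebraic cycles for specific Hodge classes on Fermat/Delsarte varieties; residual open instances
listed; no claim on general Hodge.  (This file is arithmetic of CM types / finite combinatorics / analytic number theory
of the sibling's KR-free programme; it claims nothing about cycles.)

The source module's docstring (TheoremU.lean l.3–46), verbatim:

## THEOREM U from LEMMA W — the all-unit case of THEOREM D6 reduced to a character-free statement about residues
## (`tables/SEMI-THEOREM.md` §2, `tables/KR-FREE.md` §7; build hodge-fermat, generation 22, addendum)

After `PropL7c.lean` the kernel holds THEOREM D6 modulo THEOREM U alone (`theoremD6_of_U : ThmU → D6`), where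
`ThmU` (all six entries units, same CM type ⟹ the first entry of `T` occurs in `T'` mod `N`) is proved by hand in
`tables/SEMI-THEOREM.md` §2 with Dirichlet characters: the Koblitz–Rohrlich lemma `ĥ(χ) = β̂(χ)·Σ_{a∈T} χ(a)`,
`B_{1,ψ} ≠ 0`, the uncertainty principle on `(ℤ/m)ˣ`, and LEMMA S (`s(m) < 1/6`).  This file moves the boundary
between the kernel and the by-hand part down to ONE character-free, finitely checkable statement per level:

LEMMA W (level `N`) [`LemmaW N`].  Let `w : [0, N) → ℤ` be supported on the units of `ℤ/N`, ODD (`w(N − x) = −w(x)`),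
with AT MOST 12-point support, and suppose its RESIDUE TRANSFORM vanishes at every unit:
`Σ_x w(x)·⟨tx⟩_N = 0` for all `t ∈ (ℤ/N)ˣ` [`resTransform`].  Then `w = 0`.

THEOREM [`thmU_of_W`].  LEMMA W at every squarefree `N > 1` prime to 6 [`HypW`] implies `ThmU`; hence
[`theoremD6_of_W`] THEOREM D6 holds given `HypW` — `theoremD6_of_W : HypW → D6`, axioms `propext`, `Classical.choice`,
`Quot.sound` only.

Proof of the theorem (kernel, elementary; `allunit_share`).  For all-unit triples `T = (a, b, c)`, `T' = (a', b', c')`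
of level `N` with the same CM type, the carries agree at every unit `t` (`rsum_eq_of_sameType`, from `rsum_cases` of
`LemmaN.lean`): `⟨ta⟩ + ⟨tb⟩ + ⟨tc⟩ = ⟨ta'⟩ + ⟨tb'⟩ + ⟨tc'⟩`.  Put `w = 1_T − 1_{T'} − 1_{−T} + 1_{−T'}` on residues
[`wt`; entries reduced mod `N`, `−x` realised as `N − x`].  It is odd [`wt_odd`], supported on the ≤ 12 residues
`±T ∪ ±T'` (all units), and since `⟨t(N − x)⟩ = N − ⟨tx⟩` for units [`neg_res`] its residue transform at a unit `t` is
`(R − R') − (3N − R) + (3N − R') = 2(R − R') = 0` [`transform_wt`].  By LEMMA W, `w = 0`.  Evaluating at `x = ā`: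
if `ā ∉ T'` then `w(ā) = #{ā in T} + #{−ā in T'} − #{−ā in T} ≥ 1 − #{−ā in T}`, and `−ā ∈ T` is impossible
(`ā ≡ −ā` forces `2 ∣ N`; `b̄ ≡ −ā` or `c̄ ≡ −ā` forces `N ∣ c` resp. `N ∣ b`) — so `w(ā) ≥ 1`, contradiction.  Hence
`a ≡ a'`, `b'` or `c'` (mod `N`).  (Level `N = 1` is trivial.)

Why `HypW` is true (by hand; `tables/SEMI-THEOREM.md` §2, LEMMA W).  On `G = (ℤ/m)ˣ` the residue transform is
diagonalised by Dirichlet characters: for `w = χ̄` it is `t ↦ S(χ̄)·χ(t)` with `S(χ) = Σ_{s∈G} ⟨s⟩χ(s)`; for odd `χ`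
of conductor `f`, `S(χ) = −m·B_{1,χ_f}·Π_{p ∣ m/f}(1 − χ_f(p))` up to sign (the K-R lemma), which vanishes iff `χ` is
BAD (`χ_f(p) = 1` for some `p ∣ m/f`), because `B_{1,ψ} = −L(0, ψ) ≠ 0` for primitive odd `ψ`.  So for an odd `w` with
vanishing transform, `ŵ` is supported on the bad odd characters, of which there are `s(m)·φ(m)/2 < φ(m)/12` when `m`
is squarefree, odd and `m ∉ {21, 39}` (LEMMA S; none at all when `m` is prime); the uncertainty principle
`#supp w · #supp ŵ ≥ φ(m)` with `#supp w ≤ 12` forces `w = 0`.  The levels `21, 39` are excluded by `3 ∤ N`.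
A numerical cross-check of the dictionary at small levels (`code/gen22/lemmaW_check.py`: for every squarefree
`N ≤ 215` prime to 6, the rational nullity of the odd residue transform equals the number of bad odd characters,
`12·#bad < φ(N)`, and the exact minimum support of a non-zero odd kernel weight exceeds 12 wherever the nullity is
`≤ 4`) is recorded in `results/gen22/local/lemmaW_check_215.txt`.

So THEOREM D6 is kernel-checked modulo LEMMA W — a statement about the integer matrix `(⟨ta⟩_N)` on the units of
`ℤ/N`, with no CM types, characters or L-values in it — in place of THEOREM U.  `theoremD6_of_U` remains available for
readers who prefer THEOREM U as the named input.  No `sorry`, no `native_decide`.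
-/

set_option autoImplicit false

namespace HodgeFermat.KRFree.TheoremU

open Finset HodgeFermat.KRFree HodgeFermat.KRFree.LemmaN HodgeFermat.KRFree.TheoremD6

open HodgeFermat.KRFree.PropZ5 (mul_mod_mod)

/-! ## LEMMA W — the statement -/

/-- the RESIDUE TRANSFORM of a weight `w` on `ℤ/N`:  `t ↦ Σ_{x < N} w(x) · ⟨tx⟩_N` -/
def resTransform (N : ℕ) (w : ℕ → ℤ) (t : ℕ) : ℤ :=
  ∑ x ∈ range N, w x * ((t * x % N : ℕ) : ℤ)

/-- LEMMA W at level `N` (`tables/SEMI-THEOREM.md` §2, LEMMA W): an integer weight `w` on the units of `ℤ/N`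
(zero off `[0, N)` and off the units) which is ODD (`w(N − x) = −w(x)`), is supported on AT MOST 12 residues, and
whose residue transform vanishes at every unit `t`, is identically zero. -/
def LemmaW (N : ℕ) : Prop :=
  ∀ w : ℕ → ℤ,
    (∀ x, N ≤ x → w x = 0) →
    (∀ x, ¬ Nat.Coprime x N → w x = 0) →
    (∀ x, 0 < x → x < N → w (N - x) = - w x) →
    ((range N).filter (fun x => w x ≠ 0)).card ≤ 12 →
    (∀ t, Nat.Coprime t N → resTransform N w t = 0) →
    ∀ x, w x = 0

/-- LEMMA W at every squarefree level `N > 1` prime to 6 — the hypothesis under which THEOREM U, and with it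
THEOREM D6, is derived below. -/
def HypW : Prop :=
  ∀ N, 1 < N → Squarefree N → ¬ 2 ∣ N → ¬ 3 ∣ N → LemmaW N

/-! ## Elementary lemmas -/

/-- Iverson bracket `[x = y]` -/
def δ (x y : ℕ) : ℤ := if x = y then 1 else 0

/-- `δ x y ≥ 0` -/
lemma δ_nonneg (x y : ℕ) : 0 ≤ δ x y := by
  unfold δ; split_ifs <;> norm_num

/-- `δ x x = 1` -/
lemma δ_self (x : ℕ) : δ x x = 1 := by simp [δ]

/-- `δ x y = 0` for `x ≠ y` -/
lemma δ_ne {x y : ℕ} (h : x ≠ y) : δ x y = 0 := by simp [δ, h]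

/-- the residue transform of a single bracket `[· = y]`, `y ≤ N`, is `t ↦ ⟨ty⟩_N` -/
lemma transform_δ (N y t : ℕ) (hy : y ≤ N) :
    ∑ x ∈ range N, δ x y * ((t * x % N : ℕ) : ℤ) = ((t * y % N : ℕ) : ℤ) := by
  rcases Nat.lt_or_ge y N with hlt | hge
  · rw [Finset.sum_eq_single y]
    · simp [δ]
    · intro x _ hxy
      simp [δ, hxy]
    · intro hy'
      exact absurd (mem_range.mpr hlt) hy'
  · have hyN : y = N := le_antisymm hy hge
    rw [Finset.sum_eq_zero]
    · rw [hyN, Nat.mul_mod_left]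
      simp
    · intro x hx
      have hx' : x ≠ y := by have := mem_range.mp hx; omega
      simp [δ, hx']

/-- `⟨t(N − y)⟩_N + ⟨ty⟩_N = N` when `N ∤ ty` (negation symmetry of residues) -/
lemma neg_res {N y t : ℕ} (hN : 0 < N) (hy : y ≤ N) (h : ¬ N ∣ t * y) :
    t * (N - y) % N + t * y % N = N := by
  have hsum : N ∣ t * (N - y) % N + t * y % N := by
    apply Nat.dvd_of_mod_eq_zero
    rw [← Nat.add_mod, ← Nat.mul_add, Nat.sub_add_cancel hy]
    exact Nat.mod_eq_zero_of_dvd (dvd_mul_left _ _)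
  have b1 := Nat.mod_lt (t * (N - y)) hN
  have b2 := Nat.mod_lt (t * y) hN
  have hne : t * y % N ≠ 0 := fun e => h (Nat.dvd_of_mod_eq_zero e)
  obtain ⟨c, hc⟩ := hsum
  rcases Nat.lt_or_ge c 2 with hc2 | hc2
  · interval_cases c <;> omega
  · have : N * 2 ≤ N * c := Nat.mul_le_mul_left _ hc2
    omega

/-- the residue of a unit is a unit -/
lemma coprime_mod {a N : ℕ} (h : Nat.Coprime a N) : Nat.Coprime (a % N) N := by
  unfold Nat.Coprime at h ⊢
  rw [← Nat.gcd_rec, Nat.gcd_comm]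
  exact h

/-- a unit is not a multiple of `N > 1` -/
lemma not_dvd_of_coprime {x N : ℕ} (h1 : 1 < N) (h : Nat.Coprime x N) : ¬ N ∣ x := fun hd =>
  absurd (Nat.Coprime.eq_one_of_dvd h.symm hd) (by omega)

/-- a unit mod `N > 1` is positive -/
lemma pos_of_coprime {x N : ℕ} (h1 : 1 < N) (h : Nat.Coprime x N) : 0 < x := by
  rcases Nat.eq_zero_or_pos x with hx | hx
  · subst hx
    rw [Nat.coprime_zero_left] at h
    omega
  · exact hx

/-- `N − y` is a unit when `y` is -/
lemma coprime_sub {y N : ℕ} (hy : y ≤ N) (h : Nat.Coprime y N) : Nat.Coprime (N - y) N := by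
  rw [Nat.Coprime] at h ⊢
  have h1 : Nat.gcd (N - y) N ∣ N := Nat.gcd_dvd_right _ _
  have h2 : Nat.gcd (N - y) N ∣ N - y := Nat.gcd_dvd_left _ _
  have h3 : Nat.gcd (N - y) N ∣ y := by
    have := Nat.dvd_sub h1 h2
    rwa [Nat.sub_sub_self hy] at this
  have h4 : Nat.gcd (N - y) N ∣ Nat.gcd y N := Nat.dvd_gcd h3 h1
  rw [h] at h4
  exact Nat.eq_one_of_dvd_one h4

/-- two triples of the same CM type, each with a unit third entry, have equal residue sums at every unit -/
lemma rsum_eq_of_sameType {N a b c a' b' c' t : ℕ} (hN : 0 < N) (hs : N ∣ a + b + c)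
    (hs' : N ∣ a' + b' + c') (hc : ¬ N ∣ t * c) (hc' : ¬ N ∣ t * c')
    (hT : SameType N (a, b, c) (a', b', c')) (ht : Nat.Coprime t N) :
    rsum N (a, b, c) t = rsum N (a', b', c') t := by
  obtain ⟨h1, h2⟩ := rsum_cases hN hs hc
  obtain ⟨h1', h2'⟩ := rsum_cases hN hs' hc'
  have h := hT t ht
  rw [h2, h2'] at h
  rcases h1 with e | e <;> rcases h1' with e' | e'
  · omega
  · exact absurd (h.mp e) (by omega)
  · exact absurd (h.mpr e') (by omega)
  · omega

/-! ## The odd weight of a pair of triples -/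

/-- the odd weight `w = 1_T − 1_{T'} − 1_{−T} + 1_{−T'}` of the residues `A, B, C` / `A', B', C'` -/
def wt (N A B C A' B' C' : ℕ) (x : ℕ) : ℤ :=
  (δ x A + δ x B + δ x C) - (δ x A' + δ x B' + δ x C')
    - (δ x (N - A) + δ x (N - B) + δ x (N - C)) + (δ x (N - A') + δ x (N - B') + δ x (N - C'))

/-- the weight `wt` vanishes off the twelve listed residues -/
lemma wt_eq_zero_of_ne {N A B C A' B' C' x : ℕ} (h1 : x ≠ A) (h2 : x ≠ B) (h3 : x ≠ C) (h4 : x ≠ A')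
    (h5 : x ≠ B') (h6 : x ≠ C') (h7 : x ≠ N - A) (h8 : x ≠ N - B) (h9 : x ≠ N - C) (h10 : x ≠ N - A')
    (h11 : x ≠ N - B') (h12 : x ≠ N - C') : wt N A B C A' B' C' x = 0 := by
  unfold wt
  rw [δ_ne h1, δ_ne h2, δ_ne h3, δ_ne h4, δ_ne h5, δ_ne h6, δ_ne h7, δ_ne h8, δ_ne h9, δ_ne h10,
    δ_ne h11, δ_ne h12]
  norm_num

/-- the residue transform of the weight, termwise -/
lemma transform_wt (N A B C A' B' C' t : ℕ) (hA : A ≤ N) (hB : B ≤ N) (hC : C ≤ N) (hA' : A' ≤ N)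
    (hB' : B' ≤ N) (hC' : C' ≤ N) :
    resTransform N (wt N A B C A' B' C') t =
      (((t * A % N : ℕ) : ℤ) + ((t * B % N : ℕ) : ℤ) + ((t * C % N : ℕ) : ℤ))
      - (((t * A' % N : ℕ) : ℤ) + ((t * B' % N : ℕ) : ℤ) + ((t * C' % N : ℕ) : ℤ))
      - (((t * (N - A) % N : ℕ) : ℤ) + ((t * (N - B) % N : ℕ) : ℤ) + ((t * (N - C) % N : ℕ) : ℤ))
      + (((t * (N - A') % N : ℕ) : ℤ) + ((t * (N - B') % N : ℕ) : ℤ) + ((t * (N - C') % N : ℕ) : ℤ)) := by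
  unfold resTransform wt
  simp only [add_mul, sub_mul, sum_add_distrib, sum_sub_distrib]
  rw [transform_δ N A t hA, transform_δ N B t hB, transform_δ N C t hC, transform_δ N A' t hA',
    transform_δ N B' t hB', transform_δ N C' t hC', transform_δ N (N - A) t (Nat.sub_le _ _),
    transform_δ N (N - B) t (Nat.sub_le _ _), transform_δ N (N - C) t (Nat.sub_le _ _),
    transform_δ N (N - A') t (Nat.sub_le _ _), transform_δ N (N - B') t (Nat.sub_le _ _),
    transform_δ N (N - C') t (Nat.sub_le _ _)]

/-- the weight is odd -/
lemma wt_odd (N A B C A' B' C' x : ℕ) (hx0 : 0 < x) (hxN : x < N) :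
    wt N A B C A' B' C' (N - x) = - wt N A B C A' B' C' x := by
  have e1 : (N - x = A) ↔ (x = N - A) := by omega
  have e2 : (N - x = B) ↔ (x = N - B) := by omega
  have e3 : (N - x = C) ↔ (x = N - C) := by omega
  have e4 : (N - x = A') ↔ (x = N - A') := by omega
  have e5 : (N - x = B') ↔ (x = N - B') := by omega
  have e6 : (N - x = C') ↔ (x = N - C') := by omega
  have f1 : (N - x = N - A) ↔ (x = A) := by omega
  have f2 : (N - x = N - B) ↔ (x = B) := by omega
  have f3 : (N - x = N - C) ↔ (x = C) := by omega
  have f4 : (N - x = N - A') ↔ (x = A') := by omega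
  have f5 : (N - x = N - B') ↔ (x = B') := by omega
  have f6 : (N - x = N - C') ↔ (x = C') := by omega
  simp only [wt, δ, e1, e2, e3, e4, e5, e6, f1, f2, f3, f4, f5, f6]
  ring

/-! ## THEOREM U from LEMMA W -/

/-- the all-unit case at a level `N > 1`, `N` odd, given LEMMA W at `N`: two all-unit triples of the same CM type
share their first entry with the other triple.  (Squarefreeness and `3 ∤ N` are not used here; they only select
the levels at which LEMMA W is asserted.) -/
theorem allunit_share (N a b c a' b' c' : ℕ) (hW : LemmaW N) (h1N : 1 < N) (h2 : ¬ 2 ∣ N)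
    (hs : N ∣ a + b + c) (hs' : N ∣ a' + b' + c')
    (ha : Nat.Coprime a N) (hb : Nat.Coprime b N) (hc : Nat.Coprime c N)
    (ha' : Nat.Coprime a' N) (hb' : Nat.Coprime b' N) (hc' : Nat.Coprime c' N)
    (hT : SameType N (a, b, c) (a', b', c')) :
    a ≡ a' [MOD N] ∨ a ≡ b' [MOD N] ∨ a ≡ c' [MOD N] := by
  have hN : 0 < N := by omega
  -- the six residues
  obtain ⟨A, hA⟩ : ∃ A, A = a % N := ⟨_, rfl⟩
  obtain ⟨B, hB⟩ : ∃ B, B = b % N := ⟨_, rfl⟩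
  obtain ⟨C, hC⟩ : ∃ C, C = c % N := ⟨_, rfl⟩
  obtain ⟨A', hA'⟩ : ∃ A', A' = a' % N := ⟨_, rfl⟩
  obtain ⟨B', hB'⟩ : ∃ B', B' = b' % N := ⟨_, rfl⟩
  obtain ⟨C', hC'⟩ : ∃ C', C' = c' % N := ⟨_, rfl⟩
  have lA : A < N := hA ▸ Nat.mod_lt _ hN
  have lB : B < N := hB ▸ Nat.mod_lt _ hN
  have lC : C < N := hC ▸ Nat.mod_lt _ hN
  have lA' : A' < N := hA' ▸ Nat.mod_lt _ hN
  have lB' : B' < N := hB' ▸ Nat.mod_lt _ hN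
  have lC' : C' < N := hC' ▸ Nat.mod_lt _ hN
  have cA : Nat.Coprime A N := hA ▸ coprime_mod ha
  have cB : Nat.Coprime B N := hB ▸ coprime_mod hb
  have cC : Nat.Coprime C N := hC ▸ coprime_mod hc
  have cA' : Nat.Coprime A' N := hA' ▸ coprime_mod ha'
  have cB' : Nat.Coprime B' N := hB' ▸ coprime_mod hb'
  have cC' : Nat.Coprime C' N := hC' ▸ coprime_mod hc'
  have pA := pos_of_coprime h1N cA
  have pB := pos_of_coprime h1N cB
  have pC := pos_of_coprime h1N cC
  have pA' := pos_of_coprime h1N cA'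
  have pB' := pos_of_coprime h1N cB'
  have pC' := pos_of_coprime h1N cC'
  have nA := coprime_sub lA.le cA
  have nB := coprime_sub lB.le cB
  have nC := coprime_sub lC.le cC
  have nA' := coprime_sub lA'.le cA'
  have nB' := coprime_sub lB'.le cB'
  have nC' := coprime_sub lC'.le cC'
  -- LEMMA W applied to the odd weight
  have hw0 : ∀ x, wt N A B C A' B' C' x = 0 := by
    refine hW (wt N A B C A' B' C') ?_ ?_ ?_ ?_ ?_
    · -- zero off [0, N)
      intro x hx
      apply wt_eq_zero_of_ne <;> omega
    · -- zero off the units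
      intro x hx
      have key : ∀ y, Nat.Coprime y N → x ≠ y := fun y hy e => hx (e ▸ hy)
      exact wt_eq_zero_of_ne (key A cA) (key B cB) (key C cC) (key A' cA') (key B' cB') (key C' cC')
        (key _ nA) (key _ nB) (key _ nC) (key _ nA') (key _ nB') (key _ nC')
    · -- odd
      intro x hx0 hxN
      exact wt_odd N A B C A' B' C' x hx0 hxN
    · -- at most 12-point support
      have hsub : (range N).filter (fun x => wt N A B C A' B' C' x ≠ 0) ⊆
          ([A, B, C, A', B', C', N - A, N - B, N - C, N - A', N - B', N - C'] : List ℕ).toFinset := by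
        intro x hx
        rw [mem_filter] at hx
        rw [List.mem_toFinset]
        by_contra hnot
        simp only [List.mem_cons, not_or, List.mem_nil_iff, not_false_eq_true, and_true] at hnot
        obtain ⟨n1, n2, n3, n4, n5, n6, n7, n8, n9, n10, n11, n12⟩ := hnot
        exact hx.2 (wt_eq_zero_of_ne n1 n2 n3 n4 n5 n6 n7 n8 n9 n10 n11 n12)
      calc ((range N).filter (fun x => wt N A B C A' B' C' x ≠ 0)).card
          ≤ (([A, B, C, A', B', C', N - A, N - B, N - C, N - A', N - B', N - C'] : List ℕ).toFinset).card :=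
            card_le_card hsub
        _ ≤ ([A, B, C, A', B', C', N - A, N - B, N - C, N - A', N - B', N - C'] : List ℕ).length :=
            List.toFinset_card_le _
        _ = 12 := rfl
    · -- the residue transform vanishes at units: carries of T and T' agree, and ⟨t(N − y)⟩ = N − ⟨ty⟩
      intro t ht
      rw [transform_wt N A B C A' B' C' t lA.le lB.le lC.le lA'.le lB'.le lC'.le]
      have dA : ¬ N ∣ t * A := not_dvd_of_coprime h1N (Nat.Coprime.mul_left ht cA)
      have dB : ¬ N ∣ t * B := not_dvd_of_coprime h1N (Nat.Coprime.mul_left ht cB)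
      have dC : ¬ N ∣ t * C := not_dvd_of_coprime h1N (Nat.Coprime.mul_left ht cC)
      have dA' : ¬ N ∣ t * A' := not_dvd_of_coprime h1N (Nat.Coprime.mul_left ht cA')
      have dB' : ¬ N ∣ t * B' := not_dvd_of_coprime h1N (Nat.Coprime.mul_left ht cB')
      have dC' : ¬ N ∣ t * C' := not_dvd_of_coprime h1N (Nat.Coprime.mul_left ht cC')
      have e1 := neg_res hN lA.le dA
      have e2 := neg_res hN lB.le dB
      have e3 := neg_res hN lC.le dC
      have e4 := neg_res hN lA'.le dA'
      have e5 := neg_res hN lB'.le dB'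
      have e6 := neg_res hN lC'.le dC'
      have hcN : ¬ N ∣ t * c := not_dvd_of_coprime h1N (Nat.Coprime.mul_left ht hc)
      have hcN' : ¬ N ∣ t * c' := not_dvd_of_coprime h1N (Nat.Coprime.mul_left ht hc')
      have hR := rsum_eq_of_sameType hN hs hs' hcN hcN' hT ht
      simp only [rsum] at hR
      have r1 : t * A % N = t * a % N := by rw [hA]; exact mul_mod_mod t a N
      have r2 : t * B % N = t * b % N := by rw [hB]; exact mul_mod_mod t b N
      have r3 : t * C % N = t * c % N := by rw [hC]; exact mul_mod_mod t c N
      have r4 : t * A' % N = t * a' % N := by rw [hA']; exact mul_mod_mod t a' N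
      have r5 : t * B' % N = t * b' % N := by rw [hB']; exact mul_mod_mod t b' N
      have r6 : t * C' % N = t * c' % N := by rw [hC']; exact mul_mod_mod t c' N
      omega
  -- evaluate the weight at A
  have hwA := hw0 A
  by_contra hcon
  simp only [not_or] at hcon
  obtain ⟨m1, m2, m3⟩ := hcon
  have ne1 : A ≠ A' := fun e => m1 (by unfold Nat.ModEq; rw [← hA, ← hA', e])
  have ne2 : A ≠ B' := fun e => m2 (by unfold Nat.ModEq; rw [← hA, ← hB', e])
  have ne3 : A ≠ C' := fun e => m3 (by unfold Nat.ModEq; rw [← hA, ← hC', e])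
  have ne4 : A ≠ N - A := fun e => h2 ⟨A, by omega⟩
  have ne5 : A ≠ N - B := by
    intro e
    have hab : N ∣ a + b := by
      apply Nat.dvd_of_mod_eq_zero
      rw [Nat.add_mod, ← hA, ← hB, show A + B = N by omega, Nat.mod_self]
    have hcd : N ∣ c := (Nat.dvd_add_right hab).mp hs
    exact not_dvd_of_coprime h1N hc hcd
  have ne6 : A ≠ N - C := by
    intro e
    have hac : N ∣ a + c := by
      apply Nat.dvd_of_mod_eq_zero
      rw [Nat.add_mod, ← hA, ← hC, show A + C = N by omega, Nat.mod_self]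
    have hs2 : N ∣ a + c + b := by rw [Nat.add_right_comm]; exact hs
    have hbd : N ∣ b := (Nat.dvd_add_right hac).mp hs2
    exact not_dvd_of_coprime h1N hb hbd
  unfold wt at hwA
  rw [δ_self, δ_ne ne1, δ_ne ne2, δ_ne ne3, δ_ne ne4, δ_ne ne5, δ_ne ne6] at hwA
  have g1 := δ_nonneg A B
  have g2 := δ_nonneg A C
  have g3 := δ_nonneg A (N - A')
  have g4 := δ_nonneg A (N - B')
  have g5 := δ_nonneg A (N - C')
  omega

/-- THEOREM U (in the form `ThmU` consumed by THEOREM D6) from LEMMA W at every squarefree level `N > 1`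
prime to 6. -/
theorem thmU_of_W (hW : HypW) : ThmU := by
  intro N a b c a' b' c' hsq h2 h3 hs hs' ha hb hc ha' hb' hc' hT
  rcases Nat.lt_or_ge 1 N with h1N | hN1
  · exact allunit_share N a b c a' b' c' (hW N h1N hsq h2 h3) h1N h2 hs hs' ha hb hc ha' hb' hc' hT
  · have hN0 : N ≠ 0 := fun h => by subst h; exact not_squarefree_zero hsq
    obtain rfl : N = 1 := by omega
    exact Or.inl (Nat.modEq_one)

/-- THEOREM D6 (`tables/KR-FREE.md` §7: no disjoint coincidence of CM types at a squarefree level prime to 6)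
from LEMMA W at every squarefree level `N > 1` prime to 6 — PROPOSITION L7(c) (`propL7c`) and the reduction
`thmU_of_W` discharge the two hypotheses of `theoremD6_of`. -/
theorem theoremD6_of_W (hW : HypW) : D6 :=
  HodgeFermat.KRFree.PropL7c.theoremD6_of_U (thmU_of_W hW)

end HodgeFermat.KRFree.TheoremU
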